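import Literature.AlgebraicGeometry.AbelianSchemes.LevelStructureTwistAlongIsogeny
import Literature.AlgebraicGeometry.AbelianSchemes.PolarizedAbelianSchemeWithLevel
import Literature.AlgebraicGeometry.ModuliOfAbelianVarieties.SiegelPrincipalLevelSimilitudeTower
import Literature.AlgebraicGeometry.ModuliOfAbelianVarieties.SiegelHeckeKernelIndexSet
import Literature.AlgebraicGeometry.Motives.AbelianVarietyWeilPairingAlternating
import Literature.AlgebraicGeometry.Motives.AlgPointsMapSurjectiveAlgClosed
import Literature.AlgebraicGeometry.Motives.AbelianVarietyWeilPairingAlgClosure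
import HarnessLib

/-!
# The Hecke kernel is ISOTROPIC for the Weil pairing `ē^Θ_d` of the polarisation (Mumford §23 Thm. 2's condition)

Layer `Literature/AlgebraicGeometry/ModuliOfAbelianVarieties`, namespace `Literature.AlgebraicGeometry.ModuliOfAbelianVarieties`.
THEOREMS ONLY (no definition, no named fact, no instance, no notation, no `sorry`).

Setting ([MumfordAV1970] §20 «`e_n`, `ē^L`», §23 Thm. 2; [Lan2013PELCompactifications] §1.3.6; [MumfordFogartyKirwan1994]
Ch. 7 §3): a polarised abelian scheme `P = (A, λ, φ)` of type `δ` with a SYMPLECTIC-LIFTABLE level-`N·d` structure `φ`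
over `S`, an integral Hecke datum `γm γs = γs γm = d` with `γsᵀ E_δ γs = d E_δ`, an element `r′` of the stabiliser
`K_δ(1)` of the standard lattice (its residue `R′ = r′ mod N·d` is a symplectic similitude mod `N·d`, ★
`exists_similitudeTower`), and the HECKE KERNEL `K = φ(K₀) ≤ A(S)`, `K₀ = ker(γ̄m · R′) ⊆ (ℤ/N d)^{2g}` (the `hKr`
enumeration clause of the socket-(B) glue ★ `SiegelHeckeQuotientTripleGlue`).

* §1 `typeFormMod` bookkeeping: integer casts (`typeFormMod_intCast`), the Hecke identity
  `E_δ(N·γs z, γs z′) = N·d·E_δ(z, z′) ≡ 0 (mod N·d)` (`typeFormMod_intCast_heckeKernel_eq_zero`, over ★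
  `sum_sum_typeForm_mulVec`), and transport through the inverse of a similitude (`typeFormMod_inv_mulVec_eq_zero`);
* §2 **`exists_eq_nsmul_typeFormMod_eq_zero_of_mem_heckeKernelIndex`** — for `c ∈ K₀` and `c′ ∈ K₀` there is `c₁` with `c′ = N • c₁` and
  `E_δ(c, c₁) = 0` in `ℤ/N d` (kernel shape ★ `intCast_mul_inv_mulVec_eq_zero_iff`: `c = R′⁻¹(N·γs z)`);
* §3 **`weilPairingLevel_eq_one_of_mem_heckeKernel`** — THE ISOTROPY: at every geometric point `s̄` (algebraically closed
  `Ω` with `N·d ≠ 0` in `Ω`) and for every ample witness `Θ` of `λ̄_{s̄}` (`IsLambdaOfAt`), `ē^Θ_d(κ(s̄), σ(s̄)) = 1` for all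
  `κ, σ ∈ K` — the symplectic lift `Λ` of `φ` at `s̄` (★ `IsSymplecticLiftable.nonempty`) reads
  `ē^Θ_{Nd}(φ(c)(s̄), φ(c₁)(s̄)) = ζ^{E_δ(c, c₁)} = 1` (★ `weilPairingLevel_lift`, ★ `coe_lift_ofAdd_eq_restrictPt_section`),
  and `ē^Θ_d(κ, σ) = ē^Θ_d(κ, y^N) = ē^Θ_{Nd}(κ, y)` for `y = φ(c₁)(s̄)` (★ `weilPairingLevel_level_mul`, ★
  `weilPairingLevel_swap` over the divisible group `A_{s̄}(Ω)`).

This is the isotropy input «`e^{λ′}_d(K, K) = 1`» of the dual-side stabiliser inclusion `λ′(K) ≤ Stab(𝒩₁)` (D6 of the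
(ii)-chain of socket (B), cell `hodgecm-mathlib`, D-0151): by [MumfordAV1970] §23 Thm. 2 it is exactly the condition for
`d·λ′` to descend through `A′ → A′/K`.  Count-neutral; HC_CM is proved only modulo the 7 printed citations until rung 0
closes; nothing here is about HC.

## References
* [MumfordAV1970] D. Mumford, *Abelian Varieties* (1970), §20 (pp. 183–186), §23 Thm. 2 (p. 231).
* [Lan2013PELCompactifications] K.-W. Lan, *Arithmetic compactifications of PEL-type Shimura varieties* (2013), §1.3.6
  Def. 1.3.6.1–1.3.6.2, Lemma 1.3.6.5 (pp. 79–81).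
* [MumfordFogartyKirwan1994] D. Mumford, J. Fogarty, F. Kirwan, *GIT* 3rd ed. (1994), Ch. 7 §3 (p. 139).
* [Lang1983AbelianVarieties] S. Lang, *Abelian Varieties*, Ch. VII §2 Props. 3, 5, Thm. 5.
-/

noncomputable section

universe u

open CategoryTheory CategoryTheory.Limits AlgebraicGeometry MonoidalCategory Matrix
open scoped MonObj
open Literature.AlgebraicGeometry.AbelianSchemes Literature.AlgebraicGeometry.AbelianSchemes.AbelianSchemeOver
open Literature.AlgebraicGeometry.Motives Literature.NumberTheory.Adeles

namespace Literature.AlgebraicGeometry.ModuliOfAbelianVarieties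

variable {g : ℕ} (δ : Fin g → ℕ)

/-! ## §1 `typeFormMod` bookkeeping -/

/-- `E_δ` mod `M` on integer vectors is the reduction of the integer value `Σᵢⱼ Xᵢ (E_δ)ᵢⱼ Yⱼ`.
[cite: Lan2013PELCompactifications, §1.3.6 Def. 1.3.6.1 (pp. 79–80)] -/
theorem typeFormMod_intCast (M : ℕ) (X Y : Fin g ⊕ Fin g → ℤ) :
    typeFormMod δ M (fun i => ((X i : ℤ) : ZMod M)) (fun j => ((Y j : ℤ) : ZMod M)) =
      ((∑ i, ∑ j, X i * typeForm δ i j * Y j : ℤ) : ZMod M) := by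
  rw [typeFormMod_apply]
  push_cast
  rfl

/-- **The Hecke identity**: for an integral `γs` with `γsᵀ E_δ γs = d E_δ`,
`Σᵢⱼ (N γs z)ᵢ (E_δ)ᵢⱼ (γs z′)ⱼ = N d · Σᵢⱼ zᵢ (E_δ)ᵢⱼ z′ⱼ` (★ `sum_sum_typeForm_mulVec`: a similitude scales `E_δ`).
[cite: MumfordFogartyKirwan1994, Ch. 7 §3 (p. 139)] [cite: MumfordAV1970, §23 Thm. 2 (p. 231)] -/
theorem sum_sum_typeForm_heckeKernel {d N : ℕ} (γs : Matrix (Fin g ⊕ Fin g) (Fin g ⊕ Fin g) ℤ)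
    (hsimZ : γsᵀ * typeForm δ * γs = (d : ℤ) • typeForm δ) (z z' : Fin g ⊕ Fin g → ℤ) :
    (∑ i, ∑ j, ((N : ℤ) * (γs *ᵥ z) i) * typeForm δ i j * (γs *ᵥ z') j : ℤ) =
      (N : ℤ) * d * ∑ i, ∑ j, z i * typeForm δ i j * z' j := by
  have h1 : (∑ i, ∑ j, ((N : ℤ) * (γs *ᵥ z) i) * typeForm δ i j * (γs *ᵥ z') j : ℤ) =
      (N : ℤ) * ∑ i, ∑ j, (γs *ᵥ z) i * typeForm δ i j * (γs *ᵥ z') j := by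
    rw [Finset.mul_sum]
    refine Finset.sum_congr rfl fun i _ => ?_
    rw [Finset.mul_sum]
    refine Finset.sum_congr rfl fun j _ => ?_
    ring
  rw [h1, sum_sum_typeForm_mulVec δ γs hsimZ z z', mul_assoc]

/-- Hence in `ℤ/N d`: `E_δ(N·γs z, γs z′) = 0`. [cite: MumfordAV1970, §23 Thm. 2 (p. 231)]
[cite: MumfordFogartyKirwan1994, Ch. 7 §3 (p. 139)] -/
theorem typeFormMod_intCast_heckeKernel_eq_zero {d N : ℕ} (γs : Matrix (Fin g ⊕ Fin g) (Fin g ⊕ Fin g) ℤ)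
    (hsimZ : γsᵀ * typeForm δ * γs = (d : ℤ) • typeForm δ) (z z' : Fin g ⊕ Fin g → ℤ) :
    typeFormMod δ (N * d) (fun i => ((((N : ℤ) * (γs *ᵥ z) i : ℤ)) : ZMod (N * d)))
      (fun j => (((γs *ᵥ z') j : ℤ) : ZMod (N * d))) = 0 := by
  rw [typeFormMod_intCast, sum_sum_typeForm_heckeKernel δ γs hsimZ z z', Int.cast_mul, Int.cast_mul, Int.cast_natCast,
    Int.cast_natCast, ← Nat.cast_mul, ZMod.natCast_self, zero_mul]

/-- Transport through the INVERSE of a symplectic similitude mod `M`: if `E_δ(Γ x, Γ y) = ν E_δ(x, y)` for a unit `ν`, then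
`E_δ(u, v) = 0` implies `E_δ(Γ⁻¹ u, Γ⁻¹ v) = 0`. [cite: Lan2013PELCompactifications, §1.3.6 Def. 1.3.6.1 (pp. 79–80)] -/
theorem typeFormMod_inv_mulVec_eq_zero {M : ℕ} (Γ : GL (Fin g ⊕ Fin g) (ZMod M)) (ν : (ZMod M)ˣ)
    (hsim : ∀ x y : Fin g ⊕ Fin g → ZMod M,
      typeFormMod δ M ((Γ : Matrix (Fin g ⊕ Fin g) (Fin g ⊕ Fin g) (ZMod M)) *ᵥ x)
        ((Γ : Matrix (Fin g ⊕ Fin g) (Fin g ⊕ Fin g) (ZMod M)) *ᵥ y) = (ν : ZMod M) * typeFormMod δ M x y)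
    {u v : Fin g ⊕ Fin g → ZMod M} (huv : typeFormMod δ M u v = 0) :
    typeFormMod δ M (((Γ⁻¹ : GL (Fin g ⊕ Fin g) (ZMod M)) : Matrix (Fin g ⊕ Fin g) (Fin g ⊕ Fin g) (ZMod M)) *ᵥ u)
      (((Γ⁻¹ : GL (Fin g ⊕ Fin g) (ZMod M)) : Matrix (Fin g ⊕ Fin g) (Fin g ⊕ Fin g) (ZMod M)) *ᵥ v) = 0 := by
  have h := hsim (((Γ⁻¹ : GL (Fin g ⊕ Fin g) (ZMod M)) : Matrix _ _ (ZMod M)) *ᵥ u)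
    (((Γ⁻¹ : GL (Fin g ⊕ Fin g) (ZMod M)) : Matrix _ _ (ZMod M)) *ᵥ v)
  rw [Matrix.mulVec_mulVec, Matrix.mulVec_mulVec, ← Units.val_mul, mul_inv_cancel, Units.val_one, Matrix.one_mulVec,
    Matrix.one_mulVec, huv] at h
  exact (Units.mul_right_eq_zero ν).1 h.symm

/-! ## §2 The Hecke kernel index set: `c′ = N • c₁` with `E_δ(c, c₁) = 0` -/

/-- **For `c, c′ ∈ K₀ = ker(γ̄m · R′)` there is `c₁ ∈ (ℤ/N d)^{2g}` with `c′ = N • c₁` and `E_δ(c, c₁) = 0`** (`R′` a symplectic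
similitude mod `N·d`, invertible; `γm γs = γs γm = d`, `γsᵀ E_δ γs = d E_δ`): the kernel is `R′⁻¹(N · γs ℤ^{2g})` (★
`intCast_mul_inv_mulVec_eq_zero_iff`) and `E_δ(R′⁻¹(N γs z), R′⁻¹(γs z′)) = ν(R′)⁻¹ N d E_δ(z, z′) = 0`.
[cite: MumfordFogartyKirwan1994, Ch. 7 §3 (p. 139)] [cite: MumfordAV1970, §23 Thm. 2 (p. 231)] -/
theorem exists_eq_nsmul_typeFormMod_eq_zero_of_mem_heckeKernelIndex {N d : ℕ} (hN : N ≠ 0) (hd0 : d ≠ 0)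
    (γm γs : Matrix (Fin g ⊕ Fin g) (Fin g ⊕ Fin g) ℤ)
    (hγ1 : γm * γs = (d : ℤ) • (1 : Matrix (Fin g ⊕ Fin g) (Fin g ⊕ Fin g) ℤ))
    (hγ2 : γs * γm = (d : ℤ) • (1 : Matrix (Fin g ⊕ Fin g) (Fin g ⊕ Fin g) ℤ))
    (hsimZ : γsᵀ * typeForm δ * γs = (d : ℤ) • typeForm δ)
    (Γ : GL (Fin g ⊕ Fin g) (ZMod (N * d))) (ν : (ZMod (N * d))ˣ)
    (hsim : ∀ x y : Fin g ⊕ Fin g → ZMod (N * d),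
      typeFormMod δ (N * d) ((Γ : Matrix (Fin g ⊕ Fin g) (Fin g ⊕ Fin g) (ZMod (N * d))) *ᵥ x)
        ((Γ : Matrix (Fin g ⊕ Fin g) (Fin g ⊕ Fin g) (ZMod (N * d))) *ᵥ y) = (ν : ZMod (N * d)) * typeFormMod δ (N * d) x y)
    {c c' : Fin g ⊕ Fin g → ZMod (N * d)}
    (hc : (γm.map (Int.castRingHom (ZMod (N * d))) * (Γ : Matrix (Fin g ⊕ Fin g) (Fin g ⊕ Fin g) (ZMod (N * d)))) *ᵥ c = 0)
    (hc' : (γm.map (Int.castRingHom (ZMod (N * d))) * (Γ : Matrix (Fin g ⊕ Fin g) (Fin g ⊕ Fin g) (ZMod (N * d)))) *ᵥ c' = 0) :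
    ∃ c₁ : Fin g ⊕ Fin g → ZMod (N * d), c' = N • c₁ ∧ typeFormMod δ (N * d) c c₁ = 0 := by
  -- the kernel shape: `c = Γ⁻¹ (N γs z)`, `c′ = Γ⁻¹ (N γs z′)`
  have hΓ : (Γ : Matrix (Fin g ⊕ Fin g) (Fin g ⊕ Fin g) (ZMod (N * d))) =
      (((Γ⁻¹)⁻¹ : GL (Fin g ⊕ Fin g) (ZMod (N * d))) : Matrix (Fin g ⊕ Fin g) (Fin g ⊕ Fin g) (ZMod (N * d))) := by
    rw [inv_inv]
  rw [hΓ] at hc hc'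
  obtain ⟨z, hz⟩ := (intCast_mul_inv_mulVec_eq_zero_iff hN hd0 γm γs hγ1 hγ2 Γ⁻¹ c).1 hc
  obtain ⟨z', hz'⟩ := (intCast_mul_inv_mulVec_eq_zero_iff hN hd0 γm γs hγ1 hγ2 Γ⁻¹ c').1 hc'
  refine ⟨((Γ⁻¹ : GL (Fin g ⊕ Fin g) (ZMod (N * d))) : Matrix (Fin g ⊕ Fin g) (Fin g ⊕ Fin g) (ZMod (N * d))) *ᵥ
      fun j => (((γs *ᵥ z') j : ℤ) : ZMod (N * d)), ?_, ?_⟩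
  · -- `c′ = N • Γ⁻¹ (γs z′)`
    rw [hz', ← Matrix.mulVec_smul]
    congr 1
    funext j
    rw [Pi.smul_apply, nsmul_eq_mul, Int.cast_mul, Int.cast_natCast]
  · -- `E_δ(Γ⁻¹ (N γs z), Γ⁻¹ (γs z′)) = 0`
    rw [hz]
    exact typeFormMod_inv_mulVec_eq_zero δ Γ ν hsim (typeFormMod_intCast_heckeKernel_eq_zero δ γs hsimZ z z')

/-! ## §3 The isotropy `ē^Θ_d(κ(s̄), σ(s̄)) = 1` on the Hecke kernel -/

/-- **THE HECKE KERNEL IS ISOTROPIC FOR `ē^Θ_d`.**  Let `P = (A, λ, φ)` be a polarised abelian scheme of type `δ` with a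
symplectic-liftable level-`N·d` structure over `S`, `γm γs = γs γm = d` an integral Hecke datum with `γsᵀ E_δ γs = d E_δ`,
`r′ ∈ K_δ(1)`, and `K = φ(K₀) ≤ A(S)` the Hecke kernel, `K₀ = ker(γ̄m · (r′ mod N d))`.  Then at every geometric point `s̄`
(`Ω` algebraically closed, `N·d ≠ 0` in `Ω`) and for every ample witness `Θ` of `λ̄_{s̄}`, the level-`d` Weil pairing of
`Θ` is trivial on `K(s̄) × K(s̄)`: `ē^Θ_d(x, y) = 1` whenever `x = κ(s̄)`, `y = σ(s̄)` with `κ, σ ∈ K`.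
[cite: MumfordAV1970, §20 (pp. 183–186) and §23 Thm. 2 (p. 231)] [cite: Lan2013PELCompactifications, §1.3.6 Lemma 1.3.6.5 (p. 81)]
[cite: MumfordFogartyKirwan1994, Ch. 7 §3 (p. 139)] -/
theorem weilPairingLevel_eq_one_of_mem_heckeKernel (hδ : IsPolarizationType δ) (hg : 0 < g) {S : Scheme.{u}}
    {N d : ℕ} (hN : N ≠ 0) (hd0 : d ≠ 0) [NeZero (N * d)] (P : PolarizedAbelianSchemeWithLevel g (N * d) δ S)
    (γm γs : Matrix (Fin g ⊕ Fin g) (Fin g ⊕ Fin g) ℤ)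
    (hγ1 : γm * γs = (d : ℤ) • (1 : Matrix (Fin g ⊕ Fin g) (Fin g ⊕ Fin g) ℤ))
    (hγ2 : γs * γm = (d : ℤ) • (1 : Matrix (Fin g ⊕ Fin g) (Fin g ⊕ Fin g) ℤ))
    (hsimZ : γsᵀ * typeForm δ * γs = (d : ℤ) • typeForm δ)
    {r' : gspFinAdelic δ} (hr' : r' ∈ principalLevelSubgroup δ 1)
    {K : Subgroup P.A.Sections}
    (hKr : ∀ σ : P.A.Sections, σ ∈ K ↔ ∃ c ∈ {c : Fin g ⊕ Fin g → ZMod (N * d) |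
        (γm.map (Int.castRingHom (ZMod (N * d))) *
          Matrix.of (fun i j => integralAdeleResidue (N * d)
            ⟨((r' : GL (Fin g ⊕ Fin g) finAdeleQ) : Matrix (Fin g ⊕ Fin g) (Fin g ⊕ Fin g) finAdeleQ) i j,
              entries_mem_integralAdeles_of_mem_principalLevelSubgroup_one hr' i j⟩)) *ᵥ c = 0},
        P.level.section_ c = σ)
    ⦃Ω : Type u⦄ [Field Ω] [IsAlgClosed Ω] (s : Spec (.of Ω) ⟶ S)
    (Θ : CartierDivisor (P.A.fibre s).toAbelianVariety.X.left) (hΘa : Θ.IsAmple)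
    (hΘ : P.A.IsLambdaOfAt s P.D P.pol.lam Θ) (hNdΩ : ((N * d : ℕ) : Ω) ≠ 0)
    [IsDominant (AbelianVariety.Hom.toSchemeHom ((((d : ℕ) : ℤ)) • 𝟙 (P.A.fibre s).toAbelianVariety))]
    (κ σ : K) (x y : (P.A.fibre s).toAbelianVariety.torsionPoints Ω ((d : ℕ) : ℤ))
    (hx : (x : (P.A.fibre s).toAbelianVariety.Points Ω) = P.A.restrictPt s (κ : P.A.Sections))
    (hy : (y : (P.A.fibre s).toAbelianVariety.Points Ω) = P.A.restrictPt s (σ : P.A.Sections)) :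
    (P.A.fibre s).toAbelianVariety.weilPairingLevel Θ x y = 1 := by
  classical
  haveI : IsDominant (AbelianVariety.Hom.toSchemeHom ((((N * d : ℕ) : ℤ)) • 𝟙 (P.A.fibre s).toAbelianVariety)) :=
    AbelianVariety.isDominant_toSchemeHom_zsmul_of_ne_zero _ hNdΩ
  have hdΩ : ((d : ℕ) : Ω) ≠ 0 := fun h => hNdΩ (by rw [Nat.cast_mul, h, mul_zero])
  have hNΩ : ((N : ℕ) : Ω) ≠ 0 := fun h => hNdΩ (by rw [Nat.cast_mul, h, zero_mul])
  haveI : IsDominant (AbelianVariety.Hom.toSchemeHom ((((N : ℕ) : ℤ)) • 𝟙 (P.A.fibre s).toAbelianVariety)) :=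
    AbelianVariety.isDominant_toSchemeHom_zsmul_of_ne_zero _ hNΩ
  -- ### the residue `R′ = r′ mod N·d` is a symplectic similitude (★ `exists_similitudeTower`)
  obtain ⟨Γ, ν, hΓres, -, -, hsim⟩ := exists_similitudeTower δ hδ hg hr'
  have hR : Matrix.of (fun i j => integralAdeleResidue (N * d)
      ⟨((r' : GL (Fin g ⊕ Fin g) finAdeleQ) : Matrix (Fin g ⊕ Fin g) (Fin g ⊕ Fin g) finAdeleQ) i j,
        entries_mem_integralAdeles_of_mem_principalLevelSubgroup_one hr' i j⟩) =
      ((Γ (N * d) : GL (Fin g ⊕ Fin g) (ZMod (N * d))) : Matrix (Fin g ⊕ Fin g) (Fin g ⊕ Fin g) (ZMod (N * d))) := by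
    ext i j
    rw [Matrix.of_apply, hΓres (N * d) i j (entries_mem_integralAdeles_of_mem_principalLevelSubgroup_one hr' i j)]
  -- ### the index vectors of `κ`, `σ`, and `c₁` with `c_σ = N • c₁`, `E_δ(c_κ, c₁) = 0`
  obtain ⟨cκ, hcκ, hκ⟩ := (hKr κ).1 κ.2
  obtain ⟨cσ, hcσ, hσ⟩ := (hKr σ).1 σ.2
  rw [Set.mem_setOf_eq, hR] at hcκ hcσ
  obtain ⟨c₁, hc₁, hE⟩ := exists_eq_nsmul_typeFormMod_eq_zero_of_mem_heckeKernelIndex δ hN hd0 γm γs hγ1 hγ2 hsimZ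
    (Γ (N * d)) (ν (N * d)) (hsim (NeZero.ne (N * d))) hcκ hcσ
  -- ### the symplectic lift at `s̄` for the witness `Θ`
  obtain ⟨Λ⟩ := P.symplectic.nonempty s hΘa hΘ
  -- the level-`N d` points `X := φ(c_κ)(s̄) = x`, `Y := φ(c₁)(s̄)` with `Y ^ N = y`
  set X := Λ.lift (N * d) (Multiplicative.ofAdd cκ) with hXdef
  set Y := Λ.lift (N * d) (Multiplicative.ofAdd c₁) with hYdef
  have hXx : (X : (P.A.fibre s).toAbelianVariety.Points Ω) = x := by
    rw [hXdef, Λ.coe_lift_ofAdd_eq_restrictPt_section, hκ, hx]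
  have hYy : (Y : (P.A.fibre s).toAbelianVariety.Points Ω) ^ N = y := by
    rw [hYdef, ← SubgroupClass.coe_pow, ← map_pow, ← ofAdd_nsmul, ← hc₁, Λ.coe_lift_ofAdd_eq_restrictPt_section, hσ, hy]
  -- `ē^Θ_{Nd}(X, Y) = ζ ^ E_δ(c_κ, c₁) = 1`
  have hpair : (P.A.fibre s).toAbelianVariety.weilPairingLevel Θ X Y = 1 := by
    rw [hXdef, hYdef, Λ.weilPairingLevel_lift dvd_rfl hNdΩ, hE, ZMod.val_zero, pow_zero]
  -- ### level bookkeeping: `ē_d(x, y) = ē_d(x, Y^N) = ē_{Nd}(x, Y) = ē_{Nd}(X, Y)`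
  have hxX : (P.A.fibre s).toAbelianVariety.torsionPointsOfDvd N x = X := Subtype.ext (by
    rw [AbelianVariety.coe_torsionPointsOfDvd, hXx])
  have hyY : y = (P.A.fibre s).toAbelianVariety.torsionPointsPow N Y := Subtype.ext hYy.symm
  have hdiv := AbelianVariety.pow_surjective_of_isAlgClosed (P.A.fibre s).toAbelianVariety
  -- swap at level `d`, raise to level `N d`, swap back
  rw [AbelianVariety.weilPairingLevel_swap Θ y x (hdiv d hdΩ _) (hdiv d hdΩ _), hyY,
    ← AbelianVariety.weilPairingLevel_level_mul _ Θ Y x, hxX,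
    AbelianVariety.weilPairingLevel_swap Θ X Y (hdiv (N * d) hNdΩ _) (hdiv (N * d) hNdΩ _), hpair, inv_one, inv_one]

end Literature.AlgebraicGeometry.ModuliOfAbelianVarieties

end
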